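import Summits.QuantumFields.BalabanUV.Beta.GAN24.DerivativeRateTransferJensenMassFreeTransferWeighted
import Summits.QuantumFields.BalabanUV.Beta.GAN24.DerivativeRateTransferLoewnerGramBounded
import Summits.QuantumFields.BalabanUV.Beta.GAN24.DerivativeRateTransferLoewnerGramConverge

/-!
# `BalabanUV.Beta.GAN24.DerivativeRateTransferJensenMassFreeWeightedLedger` — binder row G-an2-4 ∕ (CONV-C), route R6 «VALUES, NOT DERIVATIVES», PART 101:
# THE WEIGHTED-MASS END, LEDGER FORM — PART 90 §3 with `hB` DISCHARGED by (CONS) (PART 94), and its RATE-FREE twin WITHOUT (CONS) (PART 99): in the RMS road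
# the limit form exists as soon as `θ < 1`, the polar schedule and the weighted-mass schedule `W₀θ^{2j}` hold — (CONS) buys the rate only
# (unit b2b-balaban-gan24-p3, gen 48; v1 — ON-REQUEST item (d) of `gen48/R6-LEDGER-NOTE.md` §4)

NOT IN PRINT; OUR PROOF (for the ROUTE; PART 90 `towerEnd_of_weightedMassSchedule` ∕ `exists_effForm_limit_of_weightedMassSchedule`, PART 94 `abs_effForm_le_of_cons`,
PART 99 `exists_effForm_limit_of_stabGram_summable` BY NAME; the choice `s_j = θ^j`).  HONEST FRAMING (cell contract, verbatim): «discharging `BetaPertH` makes Bałaban's UV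
stability UNCONDITIONAL — a real constructive-QFT result; it is NOT the continuum limit and NOT the Clay problem.»  HONEST DEPENDENCY (verbatim): «continuum YM on T⁴ ⇐
BetaPertH ∧ nine spine estimates (0/9 proved); BetaPertH ⇐ (D1) ∧ (D4) ∧ CAP+tail; G-an2-4 gates asym, D1 and NE2/3/4.»

WHAT THIS FILE PROVES (0 sorry, 0 `def`, nothing cited):
* **`towerEnd_of_weightedMassSchedule_ledger`** ∕ **`exists_effForm_limit_of_weightedMassSchedule_ledger`** — PART 90 §3's END and limit with `hB` replaced by
  the level-0 diagonal `𝒮_0(y,y) ≤ B₀` (`B = B₀ + cst∕(1−θ)`, PART 94): inputs = structure, the family `∀ s > 0` with the WEIGHTED carrier, the polar schedule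
  `e_j ≤ E₀θ_p^j`, the weighted-mass schedule `|(ℋ_jᵀG_jℋ_j)_{ab}| ≤ W₀θ^{2j}` [R9° × (H2): PART 91's reduction], (CONS) `≤ cst·θ^j` [R8°], `B₀`, `0 < θ < 1`, `0 ≤ θ_p ≤ θ`.
* **`exists_effForm_limit_of_weightedMass_noCons`** — the RATE-FREE twin: the same family and schedules, PSD carriers, a bounded diagonal, `0 < θ < 1`, and
  NO (CONS), NO `P` ⟹ `∃ 𝒮_∞, 𝒮_j(a,b) → 𝒮_∞(a,b)` (`s_j = θ^j`: `ε_j ≤ θ^j + 2E₀θ_p^j`, `δ_jW₀θ^{2(j+1)} = (1+θ^{−j})W₀θ^{2j+2} ≤ 2W₀θ²·θ^j`).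
WHAT IT DOES NOT DO: supply the weighted-mass schedule (R9° squeeze × column profile) or (CONS).  SUPPLIER work on route C-R6° (rank 2, REDUCTION); no consumer of record;
NEVER «G-an2-4 closed»; NOT (CONV-C), NOT D1, NOT `BetaPertH`, NOT continuum, NOT Clay.  Records: `HOME/b2b-balaban-gan24-p3/gen48/R6-LEDGER-NOTE.md`, `…/gen48/README.md`.
-/

noncomputable section

open Set Matrix Finset Filter Topology

namespace Summit.QuantumFields.BalabanUV.Beta.GAN24.DerivativeRateTransferJensenMassFreeWeightedLedger

open Literature.MathematicalPhysics.QuantumFieldTheory.Balaban1983to89.Beta.Composition (kkt)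
open Literature.MathematicalPhysics.QuantumFieldTheory.Balaban1983to89.Beta.CompositionSingular (effForm minOp)
open Summit.QuantumFields.BalabanUV.Beta.GAN24.DerivativeRateTransferLoewnerKKT (transpose_eq_of_posSemidef)
open Summit.QuantumFields.BalabanUV.Beta.GAN24.DerivativeRateTransferJensenMassFreeTransferWeighted (towerEnd_of_weightedMassSchedule
  exists_effForm_limit_of_weightedMassSchedule)
open Summit.QuantumFields.BalabanUV.Beta.GAN24.DerivativeRateTransferLoewnerGramBounded (abs_effForm_le_of_cons)
open Summit.QuantumFields.BalabanUV.Beta.GAN24.DerivativeRateTransferLoewnerGramConverge (exists_effForm_limit_of_stabGram_summable)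

variable {c : Type*} [Fintype c] [DecidableEq c]
variable {ι : ℕ → Type*} [∀ j, Fintype (ι j)] [∀ j, DecidableEq (ι j)]
variable {H : ∀ j, Matrix (ι j) (ι j) ℝ} {Qf : ∀ j, Matrix (ι j) (ι (j + 1)) ℝ} {Qc : ∀ j, Matrix c (ι j) ℝ}
variable {P : ∀ j, Matrix (ι (j + 1)) (ι j) ℝ} {G : ∀ j, Matrix (ι j) (ι j) ℝ} {e : ℕ → ℝ} {cst B B₀ E₀ W₀ θ θp : ℝ}

/-- **`towerEnd_of_weightedMassSchedule_ledger` — PART 90 §3's END WITH `hB` DISCHARGED** [our proof; PART 90 + PART 94]: PSD fine forms, nonsingular bordered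
matrices, `Qc (j+1) = Qc j·Qf j`, `Qc (j+1)·P j = Qc j`, symmetric carriers; the family `∀ s > 0, 0 ≤ ((1+s)(1+e_j))•H_{j+1} + (1+s⁻¹)•G_{j+1} − Qf_jᵀH_jQf_j`;
(CONS) `≤ cst·θ^j` (`0 ≤ cst`); the LEVEL-0 diagonal `𝒮_0(y,y) ≤ B₀`; the polar schedule `0 ≤ e_j ≤ E₀θ_p^j`; the WEIGHTED-MASS schedule
`|(ℋ_jᵀG_jℋ_j)_{ab}| ≤ W₀(θ²)^j`; `0 < θ < 1`, `0 ≤ θ_p ≤ θ`, `0 ≤ E₀, W₀` ⟹ `|𝒮_{j+1}(a,b) − 𝒮_j(a,b)| ≤ (cst + 2(1+2E₀)(B₀ + cst∕(1−θ)) + 4W₀θ²)·θ^j`. -/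
theorem towerEnd_of_weightedMassSchedule_ledger (hH : ∀ j, (H j).PosSemidef) (hk : ∀ j, IsUnit (kkt (H j) (Qc j)).det)
    (hcomp : ∀ j, Qc (j + 1) = Qc j * Qf j) (hPQ : ∀ j, Qc (j + 1) * P j = Qc j) (hG : ∀ j, (G j)ᵀ = G j)
    (hstab : ∀ j (s : ℝ), 0 < s →
      ((((1 + s) * (1 + e j)) • H (j + 1) + (1 + s⁻¹) • G (j + 1) - (Qf j)ᵀ * H j * Qf j).PosSemidef))
    (hcons : ∀ j (y : c), (minOp (H j) (Qc j) *ᵥ Pi.single y 1) ⬝ᵥ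
        (((P j)ᵀ * H (j + 1) * P j - H j) *ᵥ (minOp (H j) (Qc j) *ᵥ Pi.single y 1)) ≤ cst * θ ^ j)
    (hB₀ : ∀ y, effForm (H 0) (Qc 0) y y ≤ B₀) (he : ∀ j, 0 ≤ e j ∧ e j ≤ E₀ * θp ^ j)
    (hW : ∀ j a b, |((minOp (H j) (Qc j))ᵀ * G j * minOp (H j) (Qc j)) a b| ≤ W₀ * (θ ^ 2) ^ j)
    (hcst : 0 ≤ cst) (hθ : 0 < θ) (hθ1 : θ < 1) (hθp : 0 ≤ θp) (hθpθ : θp ≤ θ) (hE₀ : 0 ≤ E₀) (hW₀ : 0 ≤ W₀) :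
    ∀ j (a b : c), |effForm (H (j + 1)) (Qc (j + 1)) a b - effForm (H j) (Qc j) a b| ≤
      (cst + 2 * (1 + 2 * E₀) * (B₀ + cst / (1 - θ)) + 4 * (W₀ * θ ^ 2)) * θ ^ j :=
  towerEnd_of_weightedMassSchedule hH hk hcomp hPQ hG hstab hcons (abs_effForm_le_of_cons hH hk hPQ hcst hθ.le hθ1 hcons hB₀) he hW hθ hθ1.le hθp
    hθpθ hE₀ hW₀

/-- **`exists_effForm_limit_of_weightedMassSchedule_ledger` — THE LIMIT FORM, `hB` DISCHARGED** [our proof; PART 90 + PART 94]: under the same hypotheses there is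
`𝒮_∞` with `𝒮_j(a,b) → 𝒮_∞(a,b)` and `|𝒮_j(a,b) − 𝒮_∞(a,b)| ≤ (cst + 2(1+2E₀)(B₀ + cst∕(1−θ)) + 4W₀θ²)·θ^j∕(1−θ)`. -/
theorem exists_effForm_limit_of_weightedMassSchedule_ledger (hH : ∀ j, (H j).PosSemidef) (hk : ∀ j, IsUnit (kkt (H j) (Qc j)).det)
    (hcomp : ∀ j, Qc (j + 1) = Qc j * Qf j) (hPQ : ∀ j, Qc (j + 1) * P j = Qc j) (hG : ∀ j, (G j)ᵀ = G j)
    (hstab : ∀ j (s : ℝ), 0 < s →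
      ((((1 + s) * (1 + e j)) • H (j + 1) + (1 + s⁻¹) • G (j + 1) - (Qf j)ᵀ * H j * Qf j).PosSemidef))
    (hcons : ∀ j (y : c), (minOp (H j) (Qc j) *ᵥ Pi.single y 1) ⬝ᵥ
        (((P j)ᵀ * H (j + 1) * P j - H j) *ᵥ (minOp (H j) (Qc j) *ᵥ Pi.single y 1)) ≤ cst * θ ^ j)
    (hB₀ : ∀ y, effForm (H 0) (Qc 0) y y ≤ B₀) (he : ∀ j, 0 ≤ e j ∧ e j ≤ E₀ * θp ^ j)
    (hW : ∀ j a b, |((minOp (H j) (Qc j))ᵀ * G j * minOp (H j) (Qc j)) a b| ≤ W₀ * (θ ^ 2) ^ j)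
    (hcst : 0 ≤ cst) (hθ : 0 < θ) (hθ1 : θ < 1) (hθp : 0 ≤ θp) (hθpθ : θp ≤ θ) (hE₀ : 0 ≤ E₀) (hW₀ : 0 ≤ W₀) :
    ∃ Sinf : Matrix c c ℝ, ∀ a b : c, Tendsto (fun j => effForm (H j) (Qc j) a b) atTop (𝓝 (Sinf a b)) ∧
      ∀ j, |effForm (H j) (Qc j) a b - Sinf a b| ≤ (cst + 2 * (1 + 2 * E₀) * (B₀ + cst / (1 - θ)) + 4 * (W₀ * θ ^ 2)) * θ ^ j / (1 - θ) :=
  exists_effForm_limit_of_weightedMassSchedule hH hk hcomp hPQ hG hstab hcons (abs_effForm_le_of_cons hH hk hPQ hcst hθ.le hθ1 hcons hB₀) he hW hθ hθ1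
    hθp hθpθ hE₀ hW₀

/-- **`exists_effForm_limit_of_weightedMass_noCons` — THE RATE-FREE WEIGHTED END, WITHOUT (CONS)** [our proof; PART 99 + the choice `s_j = θ^j`]: PSD fine forms,
nonsingular bordered matrices, `Qc (j+1) = Qc j·Qf j`, PSD carriers; the family `∀ s > 0` with the weighted carrier; the polar schedule `0 ≤ e_j ≤ E₀θ_p^j`
(`0 ≤ θ_p ≤ θ`); the weighted-mass schedule `|(ℋ_jᵀG_jℋ_j)_{ab}| ≤ W₀(θ²)^j`; a bounded diagonal `𝒮_j(a,a) ≤ B`; `0 < θ < 1`, `0 ≤ E₀, W₀` — and NO (CONS), NO `P` ⟹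
`∃ 𝒮_∞, ∀ a b, 𝒮_j(a,b) → 𝒮_∞(a,b)`. -/
theorem exists_effForm_limit_of_weightedMass_noCons (hH : ∀ j, (H j).PosSemidef) (hk : ∀ j, IsUnit (kkt (H j) (Qc j)).det)
    (hcomp : ∀ j, Qc (j + 1) = Qc j * Qf j) (hGp : ∀ j, (G j).PosSemidef)
    (hstab : ∀ j (s : ℝ), 0 < s →
      ((((1 + s) * (1 + e j)) • H (j + 1) + (1 + s⁻¹) • G (j + 1) - (Qf j)ᵀ * H j * Qf j).PosSemidef))
    (he : ∀ j, 0 ≤ e j ∧ e j ≤ E₀ * θp ^ j)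
    (hW : ∀ j a b, |((minOp (H j) (Qc j))ᵀ * G j * minOp (H j) (Qc j)) a b| ≤ W₀ * (θ ^ 2) ^ j)
    (hB : ∀ j a, effForm (H j) (Qc j) a a ≤ B)
    (hθ : 0 < θ) (hθ1 : θ < 1) (hθp : 0 ≤ θp) (hθpθ : θp ≤ θ) (hE₀ : 0 ≤ E₀) (hW₀ : 0 ≤ W₀) :
    ∃ Sinf : Matrix c c ℝ, ∀ a b : c, Tendsto (fun j => effForm (H j) (Qc j) a b) atTop (𝓝 (Sinf a b)) := by
  have hθp1 : θp < 1 := lt_of_le_of_lt hθpθ hθ1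
  -- geometric partial sums
  have hgeom : ∀ {x : ℝ}, 0 ≤ x → x < 1 → ∀ n, ∑ i ∈ range n, x ^ i ≤ 1 / (1 - x) := fun {x} hx0 hx1 n => by
    have h := mul_neg_geom_sum x n
    rw [le_div_iff₀ (sub_pos.mpr hx1), mul_comm, h]
    linarith [pow_nonneg hx0 n]
  refine exists_effForm_limit_of_stabGram_summable (ε := fun j => (1 + θ ^ j) * (1 + e j) - 1) (δ := fun j => 1 + (θ ^ j)⁻¹)
    (N := fun j => W₀ * (θ ^ 2) ^ j) (Sε := 1 / (1 - θ) + 2 * (E₀ * (1 / (1 - θp)))) (Sδ := 2 * (W₀ * θ ^ 2) * (1 / (1 - θ)))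
    hH hk hcomp hGp (fun j => ?_) (fun j => by have := pow_pos hθ j; positivity)
    (fun j => by simpa only [add_sub_cancel] using hstab j (θ ^ j) (pow_pos hθ j)) (fun n => ?_) hW (fun n => ?_) hB
  · -- `0 ≤ ε_j`
    have hθj : 0 ≤ θ ^ j := pow_nonneg hθ.le j
    nlinarith [(he j).1]
  · -- `Σ ε_i ≤ 1∕(1−θ) + 2E₀∕(1−θ_p)`
    have hterm : ∀ i, (1 + θ ^ i) * (1 + e i) - 1 ≤ θ ^ i + 2 * (E₀ * θp ^ i) := fun i => by
      have hθi : 0 ≤ θ ^ i := pow_nonneg hθ.le i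
      have hθi1 : θ ^ i ≤ 1 := pow_le_one₀ hθ.le hθ1.le
      obtain ⟨he0, he1⟩ := he i
      nlinarith [mul_le_mul_of_nonneg_left he1 hθi]
    calc ∑ i ∈ range n, ((1 + θ ^ i) * (1 + e i) - 1) ≤ ∑ i ∈ range n, (θ ^ i + 2 * (E₀ * θp ^ i)) :=
          Finset.sum_le_sum fun i _ => hterm i
      _ = ∑ i ∈ range n, θ ^ i + 2 * (E₀ * ∑ i ∈ range n, θp ^ i) := by
          rw [Finset.sum_add_distrib, Finset.mul_sum, Finset.mul_sum]
      _ ≤ 1 / (1 - θ) + 2 * (E₀ * (1 / (1 - θp))) := by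
          have h1 := hgeom hθ.le hθ1 n
          have h2 := mul_le_mul_of_nonneg_left (hgeom hθp hθp1 n) hE₀
          linarith
  · -- `Σ δ_i N_{i+1} = Σ (1 + θ^{-i}) W₀ θ^{2i+2} ≤ 2W₀θ²·Σ θ^i`
    have hterm : ∀ i, (1 + (θ ^ i)⁻¹) * (W₀ * (θ ^ 2) ^ (i + 1)) ≤ 2 * (W₀ * θ ^ 2) * θ ^ i := fun i => by
      have hθi : 0 < θ ^ i := pow_pos hθ i
      have hθi1 : θ ^ i ≤ 1 := pow_le_one₀ hθ.le hθ1.le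
      have e1 : (1 + (θ ^ i)⁻¹) * (W₀ * (θ ^ 2) ^ (i + 1)) = W₀ * θ ^ 2 * θ ^ i * (θ ^ i + 1) := by
        have hp : (θ ^ 2) ^ (i + 1) = θ ^ i * θ ^ i * θ ^ 2 := by
          rw [pow_succ, ← pow_mul, mul_comm 2 i, pow_mul, sq]
        rw [hp]
        field_simp
      rw [e1]
      have hW2 : 0 ≤ W₀ * θ ^ 2 * θ ^ i := by positivity
      nlinarith
    calc ∑ i ∈ range n, (1 + (θ ^ i)⁻¹) * (W₀ * (θ ^ 2) ^ (i + 1)) ≤ ∑ i ∈ range n, 2 * (W₀ * θ ^ 2) * θ ^ i :=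
          Finset.sum_le_sum fun i _ => hterm i
      _ = 2 * (W₀ * θ ^ 2) * ∑ i ∈ range n, θ ^ i := (Finset.mul_sum _ _ _).symm
      _ ≤ 2 * (W₀ * θ ^ 2) * (1 / (1 - θ)) := mul_le_mul_of_nonneg_left (hgeom hθ.le hθ1 n) (by positivity)

end Summit.QuantumFields.BalabanUV.Beta.GAN24.DerivativeRateTransferJensenMassFreeWeightedLedger

end
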